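import Mathlib
import Summits.ValiantsHypothesis.ValiantsHypothesis.Theorems.LacunarySymmetroidMatrixDescartesStubReverse
import Summits.ValiantsHypothesis.ValiantsHypothesis.Theorems.LacunarySymmetroidMatrixDescartesStubKernelData
import Summits.ValiantsHypothesis.ValiantsHypothesis.Theorems.LacunarySymmetroidMatrixDescartesStubInertiaChain

/-!
# Crux `MatrixDescartes` (stmt-ValiantsHypothesis-18050), line `Lift` — the FIRST RUNG:
# a matrix Descartes rule with one indefinite coefficient (one-sided / Loewner sector)

**Theorem (`firstRung_oneSided`).** Let `J` be a real symmetric `ι × ι` matrix, `P k ⪰ 0` positive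
semidefinite real matrices and `e, d k ∈ ℕ` exponents with the pivot exponent `e` on ONE side of all
the others: `e ≤ d k` for all `k`, or `d k ≤ e` for all `k`.  Then the determinant of the lacunary
pencil `X^e • J + ∑ₖ X^{d k} • P k` has at most `card ι` distinct POSITIVE real zeros — independently
of the number of terms and of the exponents.

This is the sign word `(+)^a [±]` / `[±] (+)^a` (one indefinite letter at an end) of the crux's
universal class (`Lines/Lift.lean`, `UniversalityV2.md`); it is tight (`X • I − diag(1,…,n)` has `n`
positive zeros) and it is the first matrix Descartes rule on this summit that tolerates an indefinite
coefficient (the definite/hyperbolic rules of Cameron–Psarrakos, doi:10.7153/oam-2019-13-48 Thm 3,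
need all coefficients definite).  The two-sided word `(+)^a [±] (+)^b` is the crux itself.

## Proof (inertia chain; all ingredients are landed stubs of the line)
Low case `e ≤ d k`: the pencil is `X^e • G(X)` with `G(t) = J + ∑ₖ t^{dₖ−e} Pₖ` Loewner non-decreasing
on `t > 0`.  If the determinant is the zero polynomial there are no roots (Mathlib convention).  Otherwise
enumerate the positive roots increasingly, `τ 0 < ⋯ < τ (k−1)` (`Finset.orderEmbOfFin`); at each root
`stub_kernelData` provides `v j ≠ 0` with `G(τ j) v j = 0` and `vⱼᵀ G(s) vⱼ > 0` for all `s > τ j`; then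
`stub_inertiaChain` (the `v j` are linearly independent) gives `k ≤ card ι`.  High case `d k ≤ e`: reflect
all exponents about `N = e` (`stub_reverse`, `X ↦ 1/X` preserves the positive-root count) and apply the
low case.  Elementary; axioms `propext`, `Classical.choice`, `Quot.sound`.
-/

-- layout Summits/ValiantsHypothesis/ValiantsHypothesis forces the duplicated namespace component
set_option linter.dupNamespace false

namespace Summit.ValiantsHypothesis.ValiantsHypothesis.Theorems.LacunarySymmetroidMatrixDescartes

open Polynomial Matrix Finset
open scoped BigOperators

/-- **First rung, low case**: if `e ≤ dₖ` for all `k`, the pencil `X^e J + ∑ X^{dₖ} Pₖ` (`J` symmetric,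
`Pₖ ⪰ 0`) has at most `card ι` distinct positive zeros of its determinant. -/
theorem firstRung_low (ι κ : Type) [Fintype ι] [DecidableEq ι] [Fintype κ] (e : ℕ) (d : κ → ℕ)
    (J : Matrix ι ι ℝ) (P : κ → Matrix ι ι ℝ) (hJ : J.IsSymm) (hP : ∀ k, (P k).PosSemidef)
    (hd : ∀ k, e ≤ d k) :
    ((Matrix.det (((Polynomial.X : Polynomial ℝ) ^ e) • J.map Polynomial.C
        + ∑ k, ((Polynomial.X : Polynomial ℝ) ^ d k) • (P k).map Polynomial.C)).roots.toFinset.filter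
          (fun t => 0 < t)).card ≤ Fintype.card ι := by
  set p := Matrix.det (((Polynomial.X : Polynomial ℝ) ^ e) • J.map Polynomial.C
        + ∑ k, ((Polynomial.X : Polynomial ℝ) ^ d k) • (P k).map Polynomial.C) with hp
  by_cases hdet : p = 0
  · simp [hdet]
  -- enumerate the positive roots increasingly
  set R := p.roots.toFinset.filter (fun t => 0 < t) with hR
  let τ : Fin R.card ↪o ℝ := R.orderEmbOfFin rfl
  have hτmem : ∀ j, τ j ∈ R := fun j => R.orderEmbOfFin_mem rfl j
  have hτpos : ∀ j, 0 < τ j := fun j => (Finset.mem_filter.1 (hτmem j)).2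
  have hτroot : ∀ j, p.IsRoot (τ j) := fun j => by
    have h1 := (Finset.mem_filter.1 (hτmem j)).1
    rw [Multiset.mem_toFinset] at h1
    exact (Polynomial.mem_roots hdet).1 h1
  -- kernel data at each root
  have hdata : ∀ j, ∃ v : ι → ℝ, v ≠ 0 ∧ (J + ∑ k, (τ j ^ (d k - e)) • P k) *ᵥ v = 0 ∧
      ∀ s : ℝ, τ j < s → 0 < v ⬝ᵥ ((J + ∑ k, (s ^ (d k - e)) • P k) *ᵥ v) := fun j =>
    stub_kernelData ι κ e d J P hJ hP hd hdet (τ j) (hτpos j) (hτroot j)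
  choose v _hv0 hker hpos using hdata
  -- the Loewner-monotone family `G(s) = J + ∑ s^{dₖ−e} Pₖ`
  have hPk : ∀ k, (P k).IsSymm := fun k => Matrix.isHermitian_iff_isSymm.1 (hP k).1
  have hG : ∀ s : ℝ, (J + ∑ k, (s ^ (d k - e)) • P k).IsSymm := by
    intro s
    unfold Matrix.IsSymm
    rw [Matrix.transpose_add, Matrix.transpose_sum, hJ.eq]
    congr 1
    exact Finset.sum_congr rfl fun k _ => by rw [Matrix.transpose_smul, (hPk k).eq]
  have hmono : ∀ s t : ℝ, 0 < s → s ≤ t →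
      ((J + ∑ k, (t ^ (d k - e)) • P k) - (J + ∑ k, (s ^ (d k - e)) • P k)).PosSemidef := by
    intro s t hs hst
    have hdiff : (J + ∑ k, (t ^ (d k - e)) • P k) - (J + ∑ k, (s ^ (d k - e)) • P k)
        = ∑ k, (t ^ (d k - e) - s ^ (d k - e)) • P k := by
      simp only [sub_smul, Finset.sum_sub_distrib]
      abel
    rw [hdiff]
    refine Matrix.posSemidef_sum Finset.univ fun k _ => ?_
    exact (hP k).smul (sub_nonneg.2 (pow_le_pow_left₀ hs.le hst _))
  exact stub_inertiaChain ι (fun s => J + ∑ k, (s ^ (d k - e)) • P k) hG hmono R.card τ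
    τ.strictMono hτpos v hker hpos

/-- **First rung, high case**: the mirror case `dₖ ≤ e` for all `k`, by the reflection `X ↦ 1/X`. -/
theorem firstRung_high (ι κ : Type) [Fintype ι] [DecidableEq ι] [Fintype κ] (e : ℕ)
    (d : κ → ℕ) (J : Matrix ι ι ℝ) (P : κ → Matrix ι ι ℝ) (hJ : J.IsSymm) (hP : ∀ k, (P k).PosSemidef)
    (hd : ∀ k, d k ≤ e) :
    ((Matrix.det (((Polynomial.X : Polynomial ℝ) ^ e) • J.map Polynomial.C
        + ∑ k, ((Polynomial.X : Polynomial ℝ) ^ d k) • (P k).map Polynomial.C)).roots.toFinset.filter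
          (fun t => 0 < t)).card ≤ Fintype.card ι := by
  rw [stub_reverse ι κ e e d J P le_rfl hd]
  exact firstRung_low ι κ (e - e) (fun k => e - d k) J P hJ hP (fun k => by omega)

/-- **The first rung of line `Lift` (one-sided matrix Descartes rule with an indefinite pivot).**
For a real symmetric `J`, positive semidefinite `P k`, and a pivot exponent `e` lying on one side of
all the `d k`, the determinant of `X^e • J + ∑ₖ X^{d k} • P k` has at most `card ι` distinct positive
zeros. [folklore-new: Loewner monotonicity + kernel chain; tight by `X•I − diag(1,…,n)`] -/
theorem firstRung_oneSided (ι κ : Type) [Fintype ι] [DecidableEq ι] [Fintype κ] (e : ℕ)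
    (d : κ → ℕ) (J : Matrix ι ι ℝ) (P : κ → Matrix ι ι ℝ) (hJ : J.IsSymm) (hP : ∀ k, (P k).PosSemidef)
    (hone : (∀ k, e ≤ d k) ∨ (∀ k, d k ≤ e)) :
    ((Matrix.det (((Polynomial.X : Polynomial ℝ) ^ e) • J.map Polynomial.C
        + ∑ k, ((Polynomial.X : Polynomial ℝ) ^ d k) • (P k).map Polynomial.C)).roots.toFinset.filter
          (fun t => 0 < t)).card ≤ Fintype.card ι := by
  rcases hone with h | h
  · exact firstRung_low ι κ e d J P hJ hP h
  · exact firstRung_high ι κ e d J P hJ hP h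

end Summit.ValiantsHypothesis.ValiantsHypothesis.Theorems.LacunarySymmetroidMatrixDescartes
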